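import Literature.Probability.RandomPlanarGeometry.ConformalRestrictionThreeLeaves
import Literature.Probability.RandomPlanarGeometry.SLERestrictionHullMartingale
import Literature.Probability.RandomPlanarGeometry.RestrictionMeasuresFiveEighthsAssembly
import Literature.Probability.RandomPlanarGeometry.SLERestrictionLemmasProofs
import Literature.Probability.RandomPlanarGeometry.SLERestrictionSmoothProofs
import Literature.Probability.RandomPlanarGeometry.SLEKappaRhoAssemblyProofs
import Literature.Probability.RandomPlanarGeometry.SLEKappaRhoDrivingProofs
import Literature.Probability.Process.PoissonCloudProofs
import HarnessLib

/-!
# [LSW] p. 5 result 2 (`LawlerSchrammWerner2003`): the assembly from the seven leaves that remain open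

G. F. Lawler, O. Schramm, W. Werner, *Conformal restriction: the chordal case*, J. Amer. Math.
Soc. **16** (2003) 917–955, arXiv:math/0209343 (**[LSW]**), p. 5 result 2 ("The only measure
`P_α` that is supported on simple curves is `P_{5/8}`. It is the law of chordal SLE_{8/3}"),
assembled in the paper from Prop. 3.3, Thm. 6.1, Thm. 7.3 and Cor. 8.6.

Book-keeping file (no new named fact, everything PROVED): it threads the discharges that have
landed in the tree since `ConformalRestrictionThreeLeaves` and `RestrictionMeasuresFiveEighthsAssembly`
were written into those assemblies, so that the named fact
`Literature.Probability.RandomPlanarGeometry.LawlerSchrammWerner2003` (`ConformalRestriction`)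
is exhibited as a consequence of exactly the leaves that are still open:

* `Literature.Probability.RandomPlanarGeometry.IsRestrictionMeasure.eq_five_eighths_of_outer_simple_of_six_leaves` —
  the uniqueness half (`IsRestrictionMeasure.eq_five_eighths_of_outer_simple`, [LSW] p. 5
  result 2 first sentence) from SIX leaves: trace existence for SLE_{8/3} (`HasSLETrace (8/3)`,
  Rohde–Schramm 2005 Thm. 5.1, feeding the symmetry sentence of p. 38 through the tree's
  `measure_I_notMem_leftFilling_sle_eq_half_of_hasSLETrace`), the martingale of [LSW]
  Lemmas 8.9–8.10 (`SLEKappaRho.exists_isOneSidedMartingale`), the comparison sentence of p. 38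
  (`SLEKappaRho.measure_I_notMem_fill_lt_of_neg`), and on the §7 side the Brownian bubble
  measure (`exists_isBrownianBubbleMeasure_ae_interior_nonempty`) and the two halves of Thm. 7.3
  (`SLEBubbles.exists_measurable_version`, `SLEBubbles.measure_disjoint`); the other four of the
  ten leaves of `IsRestrictionMeasure.eq_five_eighths_of_outer_simple_of_ten_leaves` are fed by
  their discharges `Loewner.restrictionDeriv_exitTime_gt_holds` (Lemma 6.2),
  `IsSmoothHull.restrictionDerivVanishesAtHit_holds` (Lemma 6.3),
  `SLEKappaRho.swallowingTime_ofReal_pos_holds` (Lemma 8.3 (2)) and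
  `Literature.Probability.Process.exists_isPoissonCloud_holds` (Kingman);
* `Literature.Probability.RandomPlanarGeometry.LawlerSchrammWerner2003_of_hull_leaf_facts` —
  the three-leaf assembly `LawlerSchrammWerner2003_of_local_leaf_facts''` with the restriction
  martingale of [LSW] Prop. 5.2/5.3 taken in its HULL-TIME form (`IsHullRestrictionMartingale`,
  the form of §5 proper, `T_A = inf{t : K_t ∩ A ≠ ∅}`), through
  `sle_exists_isRestrictionMartingale_of_hull`;
* `Literature.Probability.RandomPlanarGeometry.LawlerSchrammWerner2003_of_seven_leaves` — hence
  **`LawlerSchrammWerner2003` from the seven open leaves**: `HasSLETrace (8/3)`, the hull-time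
  restriction martingale, and the five non-trace leaves of the uniqueness half; and
  `…_of_cor35_of_seven_leaves`, the same with trace existence replaced by the single remaining
  stochastic leaf of the tree's proof of Rohde–Schramm Thm. 5.1, the derivative estimate
  `RohdeSchramm2005_cor35` (RS05 Cor. 3.5).

So `LawlerSchrammWerner2003_holds` is `LawlerSchrammWerner2003_of_seven_leaves` applied to the
seven `_holds` theorems once they exist.

## References

* [LSW] p. 5 result 2; Prop. 3.3 (p. 11), §5 and Thm. 6.1 (pp. 12–16), Thm. 7.3 (p. 29),
  Thm. 8.4 and Cor. 8.6 (pp. 37–38). [LawlerSchrammWerner2003Restriction]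
* S. Rohde, O. Schramm, *Basic properties of SLE*, Ann. of Math. **161** (2005), Cor. 3.5,
  Thm. 5.1. [RohdeSchramm2005]
-/

noncomputable section

open MeasureTheory
open scoped NNReal
open Literature.Probability.Process (preWienerMeasure exists_isPoissonCloud_holds)

namespace Literature.Probability.RandomPlanarGeometry

/-- **[LSW] p. 5 result 2, first sentence (outer reading), from the six open leaves.** The ten-leaf
assembly `IsRestrictionMeasure.eq_five_eighths_of_outer_simple_of_ten_leaves` with Lemma 6.2,
Lemma 6.3, Lemma 8.3 (2) and Kingman's theorem fed by their discharges, and the symmetry sentence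
of p. 38 ("which is `1/2` by symmetry") fed by its proof from trace existence.
[cite: LawlerSchrammWerner2003Restriction, p. 5 result 2; Thm. 7.3 (p. 29), Thm. 8.4 (p. 37), Cor. 8.6 (pp. 37–38)] -/
theorem IsRestrictionMeasure.eq_five_eighths_of_outer_simple_of_six_leaves
    (hgen : HasSLETrace ((8 : ℝ≥0) / 3))
    (hM : SLEKappaRho.exists_isOneSidedMartingale)
    (hlt : SLEKappaRho.measure_I_notMem_fill_lt_of_neg)
    (hμex : exists_isBrownianBubbleMeasure_ae_interior_nonempty)
    (h₁ : SLEBubbles.exists_measurable_version) (h₂ : SLEBubbles.measure_disjoint) :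
    IsRestrictionMeasure.eq_five_eighths_of_outer_simple :=
  IsRestrictionMeasure.eq_five_eighths_of_outer_simple_of_ten_leaves hM
    Loewner.restrictionDeriv_exitTime_gt_holds IsSmoothHull.restrictionDerivVanishesAtHit_holds
    SLEKappaRho.swallowingTime_ofReal_pos_holds
    (measure_I_notMem_leftFilling_sle_eq_half_of_hasSLETrace hgen) hlt hμex
    exists_isPoissonCloud_holds h₁ h₂

/-- The almost-everywhere reading (`IsRestrictionMeasure.eq_five_eighths_of_simple`) from the same
six leaves. [cite: LawlerSchrammWerner2003Restriction, p. 5 result 2] -/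
theorem IsRestrictionMeasure.eq_five_eighths_of_simple_of_six_leaves
    (hgen : HasSLETrace ((8 : ℝ≥0) / 3))
    (hM : SLEKappaRho.exists_isOneSidedMartingale)
    (hlt : SLEKappaRho.measure_I_notMem_fill_lt_of_neg)
    (hμex : exists_isBrownianBubbleMeasure_ae_interior_nonempty)
    (h₁ : SLEBubbles.exists_measurable_version) (h₂ : SLEBubbles.measure_disjoint) :
    IsRestrictionMeasure.eq_five_eighths_of_simple :=
  IsRestrictionMeasure.eq_five_eighths_of_simple_of_outer
    (IsRestrictionMeasure.eq_five_eighths_of_outer_simple_of_six_leaves hgen hM hlt hμex h₁ h₂)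

/-- **`LawlerSchrammWerner2003` from three leaves, the restriction martingale in hull-time form.**
[LSW] Prop. 5.2/5.3 state the martingale `h_t'(W_t)^{5/8}` along `T_A = inf{t : K_t ∩ A ≠ ∅}`
(§5, p. 12); given trace existence this is the trace-time form consumed by the tree
(`sle_exists_isRestrictionMartingale_of_hull`).
[cite: LawlerSchrammWerner2003Restriction, p. 5 result 2; Prop. 5.3, Thm. 6.1, Cor. 8.6] -/
theorem LawlerSchrammWerner2003_of_hull_leaf_facts (hgen : HasSLETrace ((8 : ℝ≥0) / 3))
    (hM : ∀ {A : Set ℂ}, IsStarHull A → ∃ Y, IsHullRestrictionMartingale A Y)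
    (h58 : IsRestrictionMeasure.eq_five_eighths_of_outer_simple) : LawlerSchrammWerner2003 :=
  LawlerSchrammWerner2003_of_local_leaf_facts'' hgen (sle_exists_isRestrictionMartingale_of_hull hgen hM)
    h58

/-- **`LawlerSchrammWerner2003` from the seven open leaves**: trace existence for SLE_{8/3}
(RS05 Thm. 5.1), the hull-time restriction martingale of [LSW] Prop. 5.2/5.3, the martingale of
Lemmas 8.9–8.10, the comparison sentence of p. 38, the Brownian bubble measure of §7.1 and the two
halves of Thm. 7.3.
[cite: LawlerSchrammWerner2003Restriction, p. 5 result 2; Prop. 3.3, Thm. 6.1, Thm. 7.3, Thm. 8.4, Cor. 8.6] -/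
theorem LawlerSchrammWerner2003_of_seven_leaves (hgen : HasSLETrace ((8 : ℝ≥0) / 3))
    (hM : ∀ {A : Set ℂ}, IsStarHull A → ∃ Y, IsHullRestrictionMartingale A Y)
    (hM' : SLEKappaRho.exists_isOneSidedMartingale)
    (hlt : SLEKappaRho.measure_I_notMem_fill_lt_of_neg)
    (hμex : exists_isBrownianBubbleMeasure_ae_interior_nonempty)
    (h₁ : SLEBubbles.exists_measurable_version) (h₂ : SLEBubbles.measure_disjoint) :
    LawlerSchrammWerner2003 :=
  LawlerSchrammWerner2003_of_hull_leaf_facts hgen hM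
    (IsRestrictionMeasure.eq_five_eighths_of_outer_simple_of_six_leaves hgen hM' hlt hμex h₁ h₂)

/-- The same with trace existence replaced by the derivative estimate of Rohde–Schramm Cor. 3.5
(`RohdeSchramm2005_cor35`), the single remaining stochastic leaf of the tree's proof of RS05
Thm. 5.1 at `κ = 8/3` (`hasSLETrace_of_ne_eight_of_cor35`).
[cite: LawlerSchrammWerner2003Restriction, p. 5 result 2; Prop. 3.3, Thm. 6.1, Thm. 7.3, Thm. 8.4, Cor. 8.6] -/
theorem LawlerSchrammWerner2003_of_cor35_of_seven_leaves
    (h35 : RohdeSchramm2005_cor35 preWienerMeasure)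
    (hM : ∀ {A : Set ℂ}, IsStarHull A → ∃ Y, IsHullRestrictionMartingale A Y)
    (hM' : SLEKappaRho.exists_isOneSidedMartingale)
    (hlt : SLEKappaRho.measure_I_notMem_fill_lt_of_neg)
    (hμex : exists_isBrownianBubbleMeasure_ae_interior_nonempty)
    (h₁ : SLEBubbles.exists_measurable_version) (h₂ : SLEBubbles.measure_disjoint) :
    LawlerSchrammWerner2003 :=
  LawlerSchrammWerner2003_of_seven_leaves (hasSLETrace_of_ne_eight_of_cor35 h35 (by norm_num)) hM
    hM' hlt hμex h₁ h₂

end Literature.Probability.RandomPlanarGeometry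

end
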